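import Literature.NumberTheory.ModularSymbols.CuspidalHomologyTorsionComparison
import HarnessLib

/-!
# LINE 28's mod-3 saturation hypothesis from two statements on `J₀(N)[3]`

Fifth sequel of `CuspidalHomologyShiftNorm` for bsd-stepL LINE 28: the by-name composition of the `⟨t⟩`-invariants
reduction over `𝔽₃` (`genIsotypicOne_le_range_of_fixedPart_of_fixedLatticeFibre`, `CuspidalHomologyFixedLatticeFibre`
§4) with the torsion comparison `τ₃ : H(N; 𝔽₃) ≅ J₀(N)[3]` (`CuspidalHomologyTorsionComparison` §3). Result
(`genIsotypicOne_le_range_of_torsion`): for a finite set of primes `S` and integers `a_p`, the saturation hypothesis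
`V₁(𝔽₃)[ā^∞] ⊆ (1 − t̄)V₁(𝔽₃)` of LINE 28's `PS_of` (the `genIsotypicOne … ≤ LinearMap.range (1 − shiftOneR …)`
hypothesis, `ā = a mod 3`) follows from two statements about `3`-torsion points of the complex torus `J₀(N)(ℂ)`
with its `𝕋_ℤ`-action, shift `t_*` and `B = Nm J₀(N) = normRange`:
* (J^t) every `z` with `3z = 0`, `t_* z = z` and `(T_p − a_p)^{m_p} z = 0` for some `m_p` (`p ∈ S`, `p ≠ 3`) lies in `B`;
* (B) every `z ∈ B` with `3z = 0` and `(T_p − χ₋₃(p)a_p)^{m_p} z = 0` for some `m_p` (`p ∈ S`, `p ≠ 3`) is `0`.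
No Galois action is used; (J^t) and (B) are the statements the Galois-side inputs of LINE 28 have to supply (on
`J0.tors`, where `ModularJacobianGaloisData.galAct` acts). Theorems only; no definitions, facts, instances, notation.

## References

* H. Darmon, F. Diamond, R. Taylor, *Fermat's Last Theorem*, 1995, §4.5 (p. 134: `T_ℓ J₀(N)/ℓ ≅ J₀(N)[ℓ]`).
* F. Diamond, J. Shurman, *A First Course in Modular Forms*, GTM 228, 2005, §6.3.
-/

noncomputable section

namespace Literature.NumberTheory.ModularSymbols

open Literature.NumberTheory.EllipticCurves Literature.NumberTheory.EllipticCurves.ModularForms CongruenceSubgroup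
open scoped TensorProduct

/-! ### MS's saturation hypothesis from two statements on `J₀(N)[3]` (LINE 28, by-name composition)

Composition of the `⟨t⟩`-invariants reduction over `𝔽₃` (`genIsotypicOne_le_range_of_fixedPart_of_fixedLatticeFibre`,
`CuspidalHomologyFixedLatticeFibre` §4) with the torsion comparison `τ₃ : H(N; 𝔽₃) ≅ J₀(N)[3]`
(`CuspidalHomologyTorsionComparison` §3): the saturation hypothesis `V₁(𝔽₃)[ā^∞] ⊆ (1 − t̄)V₁(𝔽₃)` of LINE 28's
`PS_of` for an integer eigen-system `a` follows from two statements about `3`-torsion points of `J₀(N)(ℂ)`: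
(J^t) a `t_*`-fixed `z ∈ J₀(N)[3]` killed by powers of the `T_p − a_p` (`p ∈ S`, `p ≠ 3`) lies in `B = Nm J₀(N)`;
(B) a `z ∈ B ∩ J₀(N)[3]` killed by powers of the `T_p − χ₋₃(p)a_p` is `0`. No Galois action is used here; (J^t) and
(B) are where the Galois-side inputs enter. -/

section SaturationOfTorsion

variable (N : ℕ) [NeZero N] (h9 : 3 ^ 2 ∣ N)

/-- `χ₋₃(p)` over `ℤ` casts to `χ₋₃(p)` over any ring. [cite: DiamondShurman2005, §6.3 (bookkeeping)] -/
theorem intCast_twistSign (R : Type*) [CommRing R] (p : ℕ) : ((twistSign ℤ p : ℤ) : R) = twistSign R p := by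
  unfold twistSign
  split_ifs <;> simp

/-- **LINE 28's saturation hypothesis from `J₀(N)[3]`**: for a finite set of primes `S` and integers `a_p`, if
(J^t) every `z ∈ J₀(N)(ℂ)` with `3z = 0`, `t_* z = z` and `(T_p − a_p)^{m_p} z = 0` for some `m_p` (`p ∈ S`, `p ≠ 3`)
lies in `B = Nm J₀(N)`, and (B) every `z ∈ B` with `3z = 0` and `(T_p − χ₋₃(p)a_p)^{m_p} z = 0` (`p ∈ S`, `p ≠ 3`)
vanishes, then `V₁(𝔽₃)[ā^∞] ⊆ (1 − t̄)V₁(𝔽₃)` — the `genIsotypicOne … ≤ LinearMap.range (1 − shiftOneR …)`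
hypothesis of `PS_of` for the system `ā = a mod 3`. [cite: DarmonDiamondTaylor1995, §4.5 (p. 134) (derived reading: `J₀(N)[3] ≅ Λ/3Λ` transports `genIsotypicOne_le_range_of_fixedPart_of_fixedLatticeFibre`)] -/
theorem genIsotypicOne_le_range_of_torsion (S : Finset ℕ) (a : ℕ → ℤ)
    (hJt : ∀ z : J0 N, 3 • z = 0 → J0.shift N h9 z = z →
      (∀ (p : ℕ) (hp : p.Prime), p ≠ 3 → p ∈ S →
        ∃ m : ℕ, (HeckeRing0.T N 2 p hp - (a p : HeckeRing0 N 2)) ^ m • z = 0) →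
      z ∈ normRange N h9)
    (hB : ∀ z ∈ normRange N h9, 3 • z = 0 →
      (∀ (p : ℕ) (hp : p.Prime), p ≠ 3 → p ∈ S →
        ∃ m : ℕ, (HeckeRing0.T N 2 p hp - ((twistSign ℤ p * a p : ℤ) : HeckeRing0 N 2)) ^ m • z = 0) →
      z = 0) :
    genIsotypicOne N h9 (ZMod 3) ↑S (fun p ↦ (a p : ZMod 3)) ≤ LinearMap.range (1 - shiftOneR N h9 (ZMod 3)) := by
  have h3 : (3 : ℕ) ≠ 0 := by norm_num
  refine genIsotypicOne_le_range_of_fixedPart_of_fixedLatticeFibre N h9 S (fun p ↦ (a p : ZMod 3)) ?_ ?_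
  · intro v hv hgen
    rw [mem_fixedLatticeFibre_iff_torsionComparison_mem_normRange N h9 h3]
    refine hJt _ (nsmul_torsionComparison N 3 v) ((mem_fixedPart_iff_shift_torsionComparison N h9 h3 v).mp hv) ?_
    intro p hp hp3 hpS
    exact (mem_maxGenEigenspace_heckeOp_iff N h3 p hp (a p) v).mp (hgen p hp hp3 hpS)
  · intro b hb hgen
    have hτ : torsionComparison N 3 b = 0 := by
      refine hB _ (torsionComparison_mem_normRange N h9 3 hb) (nsmul_torsionComparison N 3 b) ?_
      intro p hp hp3 hpS
      have h := hgen p hp hp3 hpS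
      rw [twistSystem_apply, ← intCast_twistSign (ZMod 3), ← Int.cast_mul] at h
      exact (mem_maxGenEigenspace_heckeOp_iff N h3 p hp _ b).mp h
    exact (torsionComparison_eq_zero_iff N h3 b).mp hτ

end SaturationOfTorsion

end Literature.NumberTheory.ModularSymbols

end
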